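import Literature.AlgebraicGeometry.HodgeTheory.PicardLefschetzSymmetricA3
import Literature.AlgebraicGeometry.Motives.GeneralNonsingularForms
import Mathlib.Analysis.Complex.Polynomial.Basic
import HarnessLib

/-!
# The symmetric `A₃` point: the axis members `f₁ + α g₂` and the singularity criterion on the slice
# (programme B2-BIF, stage S4a, for the binder hB2 `picardLefschetz_symmetricA3` of crux K1-B)

Family `hodge`, layer `Literature/AlgebraicGeometry/HodgeTheory`, next to `PicardLefschetzSymmetricA3` (hypotheses
`IsSymmetricA3Datum`).  Written by the prover seat `hodge-nonav-prover-Bx` (g12, cell `hodge-nonav`), programme memo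
`HOME/memos/PROGRAMME-B2BIF-Bx-g12.md`.  Chart-free algebraic facts used by the bifurcation analysis of the unfolding
`f₁ + α g₂ + β g₀`:

* `IsSymmetricA3Datum.eval_f₁` — `f₁(e_j) = 0` (Euler at the singular point);
* `IsSymmetricA3Datum.eval_pderiv_axisMember`, `eval_axisMember` — every axis member `f₁ + α g₂` (`β = 0`) is singular
  at `e_j` and vanishes there: the branch `b = 0` of the bifurcation set (AGZV II §5.2: `λ₂ = 0`);
* `slice_singular_iff` — for a form `F` of degree `d ≠ 0` and a point `x` of the slice `x_j = 1` at which the partials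
  `i ∉ {j, k}` vanish, `x` is a singular point of `F = 0` iff `F(x) = 0` and `∂ₖF(x) = 0` (Euler eliminates `∂_jF`):
  in the reduced chart this reads «`r = 0` and `u · s = 0`».

## References
* [ArnoldGuseinzadeVarchenko2012] AGZV II, Part I §5.2 (boundary singularities `B_k`, pp. 129–133).
* [Hartshorne1977] Hartshorne, I Ex. 5.8 (Euler's lemma and singular points of projective hypersurfaces).
-/

noncomputable section

open MvPolynomial
open Literature.AlgebraicGeometry.Motives Literature.AlgebraicGeometry.Motives.SmoothHypersurface

namespace Literature.AlgebraicGeometry.HodgeTheory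

section HodgeTheory

variable {n d : ℕ} {f₁ g₀ g₂ : MvPolynomial (Fin (n + 2)) ℂ} {j k : Fin (n + 2)} {a : Fin (n + 2) → ℂˣ}

/-- **Euler at a point**: `Σᵢ xᵢ ∂ᵢF(x) = d · F(x)` for a form of degree `d` (local copy of the tree's
`SmoothHypersurfaceAtlas.sum_mul_eval_pderiv_eq`, not imported to keep the closure small). [cite: Hartshorne1977, I Ex. 5.8] -/
private theorem euler_eval_point {F : MvPolynomial (Fin (n + 2)) ℂ} (hF : F.IsHomogeneous d) (x : Fin (n + 2) → ℂ) :
    ∑ i, x i * eval x (pderiv i F) = d * eval x F := by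
  have h := congr_arg (eval x) hF.sum_X_mul_pderiv
  rw [map_sum, map_nsmul, nsmul_eq_mul] at h
  rw [← h]
  exact Finset.sum_congr rfl fun i _ => by rw [map_mul, eval_X]

/-- **Singularity criterion on the slice `x_j = 1`.**  Let `F` be a form of degree `d ≠ 0` and `x` a point with
`x_j = 1` at which `∂ᵢF(x) = 0` for all `i ∉ {j, k}`.  Then all partials of `F` vanish at `x` iff `F(x) = 0` and
`∂ₖF(x) = 0` (Euler: `∂_jF(x) = d F(x) − x_k ∂ₖF(x)`). [cite: Hartshorne1977, I Ex. 5.8]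
[cite: ArnoldGuseinzadeVarchenko2012, Part I §5.2] -/
theorem slice_singular_iff {F : MvPolynomial (Fin (n + 2)) ℂ} (hF : F.IsHomogeneous d) (hd : d ≠ 0)
    (hjk : j ≠ k) {x : Fin (n + 2) → ℂ} (hxj : x j = 1)
    (hpart : ∀ i, i ≠ j → i ≠ k → eval x (pderiv i F) = 0) :
    (∀ i, eval x (pderiv i F) = 0) ↔ eval x F = 0 ∧ eval x (pderiv k F) = 0 := by
  classical
  -- Euler with only the `j`, `k` terms surviving
  have hE : eval x (pderiv j F) + x k * eval x (pderiv k F) = d * eval x F := by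
    rw [← euler_eval_point hF x, ← Finset.add_sum_erase _ _ (Finset.mem_univ j), hxj, one_mul,
      ← Finset.add_sum_erase _ _ (Finset.mem_erase.2 ⟨hjk.symm, Finset.mem_univ k⟩)]
    rw [Finset.sum_eq_zero fun i hi => ?_, add_zero]
    obtain ⟨hik, hi'⟩ := Finset.mem_erase.1 hi
    obtain ⟨hij, -⟩ := Finset.mem_erase.1 hi'
    rw [hpart i hij hik, mul_zero]
  constructor
  · intro h
    refine ⟨?_, h k⟩
    have := hE
    rw [h j, h k, mul_zero, add_zero] at this
    exact (mul_eq_zero.1 this.symm).resolve_left (Nat.cast_ne_zero.2 hd)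
  · rintro ⟨h0, hk⟩ i
    by_cases hij : i = j
    · rw [hij]
      have := hE
      rw [hk, h0, mul_zero, mul_zero, add_zero] at this
      exact this
    by_cases hik : i = k
    · rw [hik]; exact hk
    exact hpart i hij hik

namespace IsSymmetricA3Datum

/-- `f₁(e_j) = 0`: the `A₃` point lies on the hypersurface (Euler, `d ≠ 0` because `∂ₖ⁴f₁(e_j) ≠ 0`).
[cite: ArnoldGuseinzadeVarchenko2012, Part I §5.2] -/
theorem eval_f₁ (hf₁ : f₁.IsHomogeneous d) (hD : IsSymmetricA3Datum f₁ g₀ g₂ j k a) :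
    eval (Pi.single j (1 : ℂ)) f₁ = 0 := by
  have hd : d ≠ 0 := by
    rintro rfl
    have hq := hD.quartic_ne
    by_cases h0 : f₁ = 0
    · simp [h0] at hq
    · have htot : f₁.totalDegree = 0 := hf₁.totalDegree h0
      rw [totalDegree_eq_zero_iff_eq_C] at htot
      rw [htot] at hq
      simp at hq
  have h := euler_eval_point hf₁ (Pi.single j (1 : ℂ))
  rw [Finset.sum_eq_zero fun i _ => by rw [hD.eval_pderiv i, mul_zero]] at h
  exact (mul_eq_zero.1 h.symm).resolve_left (Nat.cast_ne_zero.2 hd)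

/-- **Every axis member `f₁ + α g₂` is singular at `e_j`**: all its partials vanish there (`∇f₁(e_j) = 0`,
`∇g₂(e_j) = 0`).  This is the component `b = 0` of the bifurcation set. [cite: ArnoldGuseinzadeVarchenko2012, Part I §5.2] -/
theorem eval_pderiv_axisMember (hD : IsSymmetricA3Datum f₁ g₀ g₂ j k a) (α : ℂ) (i : Fin (n + 2)) :
    eval (Pi.single j (1 : ℂ)) (pderiv i (f₁ + α • g₂ + (0 : ℂ) • g₀)) = 0 := by
  rw [zero_smul, add_zero, map_add, (pderiv i).map_smul, eval_add, smul_eval, hD.eval_pderiv i,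
    hD.2.2.2.2.2.2.2.2.2.1 i, mul_zero, add_zero]

/-- And vanishes at `e_j` (`f₁(e_j) = 0`, `g₂(e_j) = 0`). [cite: ArnoldGuseinzadeVarchenko2012, Part I §5.2] -/
theorem eval_axisMember (hf₁ : f₁.IsHomogeneous d) (hD : IsSymmetricA3Datum f₁ g₀ g₂ j k a) (α : ℂ) :
    eval (Pi.single j (1 : ℂ)) (f₁ + α • g₂ + (0 : ℂ) • g₀) = 0 := by
  rw [zero_smul, add_zero, eval_add, smul_eval, hD.eval_f₁ hf₁, hD.2.2.2.2.2.2.2.2.1, mul_zero, add_zero]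

/-- Hence an axis member `f₁ + α g₂` is never a nonsingular form. [cite: ArnoldGuseinzadeVarchenko2012, Part I §5.2] -/
theorem not_isNonsingularForm_axisMember (hf₁ : f₁.IsHomogeneous d) (hD : IsSymmetricA3Datum f₁ g₀ g₂ j k a) (α : ℂ) :
    ¬ SmoothHypersurface.IsNonsingularForm ℂ (f₁ + α • g₂ + (0 : ℂ) • g₀) := by
  intro h
  have hne : (Pi.single j (1 : ℂ) : Fin (n + 2) → ℂ) ≠ 0 := fun h0 => by
    have := congr_fun h0 j
    simp at this
  obtain ⟨i, hi⟩ := h.exists_eval_pderiv_ne_zero hne (hD.eval_axisMember hf₁ α)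
  exact hi (hD.eval_pderiv_axisMember α i)

end IsSymmetricA3Datum

end HodgeTheory

end Literature.AlgebraicGeometry.HodgeTheory

end
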